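import Summits.ABC.ABC.Theorems.DefiniteXiDefiniteRTControlPrime
import Summits.ABC.ABC.Theorems.DefiniteXiXiBoundUpgradeSharpening
import HarnessLib

/-!
# Crux `XiStrongBound` (stmt-ABC-11337), route DefiniteXi — the PRIME-RUNG DEGREE CALIBRATION:
# `ξ(N/q, q) · v_q(Δ_min) ≤ 163 · deg D · v_q(Δ_min)²` for every datum, and
# `XiStrongBoundPrime ⟺ FreyDegreeBound` modulo the known comparison facts

The crux `XiStrongBound` (r4 of route `DefiniteXi`) bounds
`ξ(E_{a,b}; N/N⁻, N⁻) · ∏_{q ∣ N⁻} v_q(Δ_min(E_{a,b})) ≤ C_ε N^{2+ε}` for every admissible `N⁻`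
(`ξ = brandtXi`).  Only its PRIME RUNG `N⁻ = q` (one odd prime of the conductor) is consumed by the
deciding theorem `closes` (through `DefiniteGlue`; recorded as
`DefiniteXiXiBoundUpgrade.minimalDegreeBound_of_primeXiStrongBound`, (E₁)).  This file certifies,
in the kernel, that this prime rung is EXACTLY of the strength of the route's thesis
`X = FreyDegreeBound` (Frey's degree conjecture on Frey–Hellegouarch curves), modulo the two
named facts that already carry the forward comparison `DefiniteRTControlPrime`
(`DefiniteRTControlPrime.definiteRTControlPrime_of_facts`): Takahashi 2001 Thm. 2.3 at `r ∥ N`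
(`takahashi2001_thm_2_3_of_coprime`) and Pasten 2024 Lemma 6.8 (`PastenShimura2024_lemma_6_8`,
= route item `IsogenyValuationTransport`, stmt-ABC-18928).

* `brandtXi_le_deg_mul_factorization` — **pointwise converse of `DefiniteRTControlPrime`**: for
  coprime `a, b` (`ab(a+b) ≠ 0`), `N` the conductor of `E = freyCurve a b`, every odd prime `q ∣ N`
  and EVERY datum `D` of the Frey model at level `N`:
  `ξ(N/q, q)(a(E)) ≤ 163 · deg D · v_q(Δ_min E)`, hence
  `ξ(N/q, q)(a(E)) · v_q(Δ_min E) ≤ 163 · deg D · v_q(Δ_min E)²`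
  (`brandtXi_mul_factorization_le`).  Chain: with `N = M q`, `gcd(M, q) = 1` (`stub_freyLocal`), the
  conductor-restricted optimal pivot `(W⋆, P⋆)` of the newform of `D` (`exists_conductorMinimal`:
  `deg P⋆ ≤ deg D`) and a Brandt setup `S` of type `(M, q)` (`nonempty_xiSetup'`), Takahashi gives
  `i, j` with `0 < i`, `i j = v_q(Δ_min W⋆)`, `deg P⋆ · i = ξ · j` (`a(W⋆) = a(E)`); so `j ≠ 0`,
  `ξ ≤ ξ j = deg P⋆ · i ≤ deg D · i ≤ deg D · i j = deg D · v_q(Δ_min W⋆) ≤ 163 · deg D · v_q(Δ_min E)`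
  (`stub_valTransport` from Lemma 6.8 along the isogeny `E ~ W⋆`, `isIsogenous_of_f_eq`).
* `primeXiStrongBound_of_freyDegreeBound` — **`FreyDegreeBound ⟹` the prime rung** modulo the two
  facts: take the datum of `FreyDegreeBound` at `ε/2` and the valuation input
  `v_q(Δ_min) ≤ C N^{ε/4}` at odd `q` (`prod_factorization_le_rpow_of_polyFreyDegree`, from
  `PolyFreyDegree ⟸ FreyDegreeBound`, both landed): `ξ v_q ≤ 163 · C₁ N^{2+ε/2} · (C₂ N^{ε/4})²`.
* `freyDegreeBound_of_primeXiStrongBound` — the prime rung `⟹ FreyDegreeBound` given the route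
  items `DefiniteRTControlPrime` and `FreyModularity` ((E₁) + `minimalBoundGivesTarget_proof`).
* `primeXiStrongBound_iff_freyDegreeBound` — **the calibration**: modulo
  {`takahashi2001_thm_2_3_of_coprime`, `PastenShimura2024_lemma_6_8`, `DefiniteRTControlPrime`,
  `FreyModularity`} the prime rung of the crux is EQUIVALENT to the thesis `X`;
  `primeXiStrongBound_iff_freyDegreeBound_of_facts` discharges `DefiniteRTControlPrime` by
  `definiteRTControlPrime_of_facts` (one more fact: `PastenShimura2024_minimalDegree_le_163_mul`,
  = route crux `MazurKenkuBound`).  `xiStrongBound_imp_freyDegreeBound_iff_prime` records that the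
  full crux enters only through this rung.

Consequence for the line programme of stmt-ABC-11337 (numbers in `Cruxes/XiStrongBound/Lines/*.dead.md`):
any line closing the crux proves `X` itself (modulo in-print facts the route already lists as r3/r9
items); there is no statement strictly between the prime rung and `X` for a line to target.  This is
the formal content of Disproof.lean §3 (`ξ(N/r,r)·c_r = deg_opt·i_r²`) transported to the Frey MODEL
and to the route's typed items.  No new definitions: the prime rung is written inline, verbatim the
hypothesis `hXSq` of (E₁).

## References

* [Takahashi2001] S. Takahashi, Degrees of parametrizations of elliptic curves by Shimura curves,
  J. Number Theory 90 (2001) 74–88, Thm. 2.3 (p. 79), remark p. 80.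
* [PastenShimura2024] H. Pasten, Shimura curves and the abc conjecture, J. Number Theory 254 (2024)
  = arXiv:1705.09251, §3 p. 13, Lemma 6.8 (p. 22).
* [Masser1990] D. W. Masser, Note on a conjecture of Szpiro, Astérisque 183 (1990) — exponent 2 sharp.
-/

set_option linter.dupNamespace false

noncomputable section

namespace Summit.ABC.ABC.Theorems.DefiniteXiXiStrongBoundPrimeCalibration

open Summit.ABC.ABC.Theses.DefiniteXi
open Literature.NumberTheory.EllipticCurves Literature.NumberTheory.EllipticCurves.ModularForms
open Literature.NumberTheory.Automorphic
open WeierstrassCurve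
open Summit.ABC.ABC.Theorems.DefiniteRTControlPrime

/-! ## (1) The pointwise converse of `DefiniteRTControlPrime` -/

/-- **`ξ(N/q, q)(a(E_{a,b})) ≤ 163 · deg D · v_q(Δ_min(E_{a,b}))` for EVERY datum `D` of the Frey
model** (coprime `a, b`, `ab(a+b) ≠ 0`, `N` the conductor, `q ∣ N` an odd prime), from Takahashi
2001 Thm. 2.3 at `q ∥ N` and Pasten 2024 Lemma 6.8: with the conductor-restricted optimal pivot
`(W⋆, P⋆)` of `D.f` and a Brandt setup of type `(N/q, q)`,
`ξ ≤ ξ j = deg P⋆ · i ≤ deg D · i ≤ deg D · i j = deg D · v_q(Δ_min W⋆) ≤ 163 · deg D · v_q(Δ_min E)`.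
[cite: Takahashi2001, Thm. 2.3 (p. 79)] [cite: PastenShimura2024, Lemma 6.8 (p. 22)] -/
theorem brandtXi_le_deg_mul_factorization (hT : takahashi2001_thm_2_3_of_coprime)
    (h68 : PastenShimura2024_lemma_6_8) {a b : ℤ} (hab : IsCoprime a b)
    (h0 : a * b * (a + b) ≠ 0) {N : ℕ} [NeZero N] (hN : (freyCurve a b).conductorNorm ℤ = N)
    {q : ℕ} (hq : q.Prime) (hq2 : q ≠ 2) (hqN : q ∣ N)
    (D : ModularParametrizationData (freyCurve a b) N) :
    brandtXi (N / q) q (fun n => (freyCurve a b).LFunction n) ≤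
      163 * D.deg * ((freyCurve a b).minimalDiscriminantNorm ℤ).factorization q := by
  -- `N = M q`
  obtain ⟨M, hM⟩ := hqN
  rw [mul_comm] at hM
  subst hM
  haveI := isElliptic_freyCurve h0
  have hdiv : M * q / q = M := Nat.mul_div_cancel M hq.pos
  rw [hdiv]
  have hqN' : q ∣ (freyCurve a b).conductorNorm ℤ := by rw [hN]; exact Dvd.intro_left M rfl
  -- `gcd(M, q) = 1`
  have hcop : M.Coprime q := by
    have h := stub_freyLocal a b hab h0 q hq hq2 hqN'
    rwa [hN, hdiv] at h
  -- the conductor-restricted optimal pivot `(W⋆, P⋆)` of the newform of `D`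
  obtain ⟨Ws, hWs, Ps, hNs, hfs, hPsmin⟩ := exists_conductorMinimal D hN
  haveI := hWs
  -- Takahashi at `(W⋆, P⋆)` in a Brandt setup `S` of type `(M, q)`
  obtain ⟨S⟩ := takahashi2001_thm_2_3_of_coprime.nonempty_xiSetup' (M := M) hq hcop
  obtain ⟨i, j, hi, hij, -, hδ⟩ := hT Ws M q hq hcop hNs Ps hPsmin S
  -- `a(W⋆) = a(E)`, and the setup computes `brandtXi`
  have hL : (fun n => Ws.LFunction n) = fun n => (freyCurve a b).LFunction n := by
    funext n
    have h1 := Ps.isNewformOf.2 n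
    have h2 := D.isNewformOf.2 n
    rw [hfs] at h1
    rw [h1] at h2
    exact_mod_cast h2
  have hδ' : Ps.modularDegree * i = brandtXi M q (fun n => (freyCurve a b).LFunction n) * j := by
    rw [Brandt.XiSetup.brandtXi_eq_xi S, ← hL]
    exact hδ
  set ξ : ℕ := brandtXi M q (fun n => (freyCurve a b).LFunction n) with hξ
  -- `j ≠ 0`
  have hj : j ≠ 0 := by
    rintro rfl
    rw [mul_zero] at hδ'
    exact (Nat.mul_pos Ps.deg_pos hi).ne' hδ'
  -- `deg P⋆ ≤ deg D` (conductor-minimality of `P⋆` at `(E, D)`)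
  have hPsD : Ps.modularDegree ≤ D.deg := hPsmin (freyCurve a b) hN D hfs.symm
  -- `v_q(Δ_min W⋆) ≤ 163 · v_q(Δ_min E)` along the isogeny `E ~ W⋆`
  have hiso : (freyCurve a b).IsIsogenous Ws := isIsogenous_of_f_eq D Ps hfs
  have hval : (Ws.minimalDiscriminantNorm ℤ).factorization q ≤
      163 * ((freyCurve a b).minimalDiscriminantNorm ℤ).factorization q :=
    stub_valTransport h68 a b hab h0 q hq hq2 hqN' Ws hiso
  -- the chain
  calc ξ ≤ ξ * j := Nat.le_mul_of_pos_right _ (Nat.pos_of_ne_zero hj)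
    _ = Ps.modularDegree * i := hδ'.symm
    _ ≤ D.deg * i := Nat.mul_le_mul_right _ hPsD
    _ ≤ D.deg * (i * j) := Nat.mul_le_mul_left _ (Nat.le_mul_of_pos_right _ (Nat.pos_of_ne_zero hj))
    _ = D.deg * (Ws.minimalDiscriminantNorm ℤ).factorization q := by rw [hij]
    _ ≤ D.deg * (163 * ((freyCurve a b).minimalDiscriminantNorm ℤ).factorization q) :=
        Nat.mul_le_mul_left _ hval
    _ = 163 * D.deg * ((freyCurve a b).minimalDiscriminantNorm ℤ).factorization q := by ring

/-- **The crux quantity at prime type against ANY datum**: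
`ξ(N/q, q)(a(E_{a,b})) · v_q(Δ_min) ≤ 163 · deg D · v_q(Δ_min)²` (multiply
`brandtXi_le_deg_mul_factorization` by `v_q(Δ_min)`).  Together with `DefiniteRTControlPrime`
(`deg D_min ≤ C_ε N^ε · ξ(N/q, q) · v_q(Δ_min)`) this is the two-sided sandwich
`deg_min ≤ C_ε N^ε · ξ v_q ≤ 163 C_ε N^ε · deg_min · v_q²` on the Frey model.
[cite: Takahashi2001, Thm. 2.3 (p. 79)] [cite: PastenShimura2024, Lemma 6.8 (p. 22)] -/
theorem brandtXi_mul_factorization_le (hT : takahashi2001_thm_2_3_of_coprime)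
    (h68 : PastenShimura2024_lemma_6_8) {a b : ℤ} (hab : IsCoprime a b)
    (h0 : a * b * (a + b) ≠ 0) {N : ℕ} [NeZero N] (hN : (freyCurve a b).conductorNorm ℤ = N)
    {q : ℕ} (hq : q.Prime) (hq2 : q ≠ 2) (hqN : q ∣ N)
    (D : ModularParametrizationData (freyCurve a b) N) :
    brandtXi (N / q) q (fun n => (freyCurve a b).LFunction n) *
        ((freyCurve a b).minimalDiscriminantNorm ℤ).factorization q ≤
      163 * D.deg * (((freyCurve a b).minimalDiscriminantNorm ℤ).factorization q) ^ 2 := by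
  calc brandtXi (N / q) q (fun n => (freyCurve a b).LFunction n) *
        ((freyCurve a b).minimalDiscriminantNorm ℤ).factorization q
      ≤ (163 * D.deg * ((freyCurve a b).minimalDiscriminantNorm ℤ).factorization q) *
          ((freyCurve a b).minimalDiscriminantNorm ℤ).factorization q :=
        Nat.mul_le_mul_right _ (brandtXi_le_deg_mul_factorization hT h68 hab h0 hN hq hq2 hqN D)
    _ = 163 * D.deg * (((freyCurve a b).minimalDiscriminantNorm ℤ).factorization q) ^ 2 := by ring

/-! ## (2) `FreyDegreeBound ⟹` the prime rung -/

/-- **`FreyDegreeBound ⟹ XiStrongBoundPrime`** (the prime rung of the crux, written inline — verbatim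
the hypothesis `hXSq` of `DefiniteXiXiBoundUpgrade.minimalDegreeBound_of_primeXiStrongBound`), modulo
Takahashi 2001 Thm. 2.3 at `q ∥ N` and Pasten 2024 Lemma 6.8.  Proof: the datum `D` of
`FreyDegreeBound` at `ε/2` has `deg D ≤ C₁ N^{2+ε/2}`; `FreyDegreeBound ⟹ PolyFreyDegree ⟹`
`v_q(Δ_min(E_{a,b})) ≤ C₂ N^{ε/4}` at every odd prime `q`
(`prod_factorization_le_rpow_of_polyFreyDegree` at `Nm = q`); and
`ξ v_q ≤ 163 · deg D · v_q²` (`brandtXi_mul_factorization_le`), so `C = 163 · C₁⁺ · (C₂⁺)²`.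
[cite: Takahashi2001, Thm. 2.3 (p. 79)] [cite: PastenShimura2024, Lemma 6.8 (p. 22)] -/
theorem primeXiStrongBound_of_freyDegreeBound (hT : takahashi2001_thm_2_3_of_coprime)
    (h68 : PastenShimura2024_lemma_6_8) (hX : FreyDegreeBound) :
    ∀ ε : ℝ, 0 < ε → ∃ C : ℝ, ∀ a b : ℤ, IsCoprime a b → a * b * (a + b) ≠ 0 →
      ∀ (N : ℕ) [NeZero N], (freyCurve a b).conductorNorm ℤ = N → ∀ q : ℕ, q.Prime → q ≠ 2 → q ∣ N →
        (brandtXi (N / q) q (fun n => (freyCurve a b).LFunction n) : ℝ) *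
          ((((freyCurve a b).minimalDiscriminantNorm ℤ).factorization q : ℕ) : ℝ) ≤
            C * (N : ℝ) ^ (2 + ε) := by
  intro ε hε
  obtain ⟨C₁, hC₁⟩ := hX (ε / 2) (by positivity)
  obtain ⟨C₂, hC₂⟩ :=
    DefiniteXiXiBoundUpgradeSharpening.prod_factorization_le_rpow_of_polyFreyDegree
      (DefiniteXiPolyFreyDegree.polyFreyDegree_of_freyDegreeBound hX) (ε / 4) (by positivity)
  refine ⟨163 * max C₁ 0 * (max C₂ 0) ^ 2, fun a b hab h0 N _ hN q hq hq2 hqN => ?_⟩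
  have hN0 : (0 : ℝ) ≤ (N : ℝ) := Nat.cast_nonneg N
  have hNpos : (0 : ℝ) < (N : ℝ) := Nat.cast_pos.mpr (Nat.pos_of_ne_zero (NeZero.ne N))
  -- the datum of `FreyDegreeBound`
  obtain ⟨D, hD⟩ := hC₁ a b hab h0 N hN
  set ξ : ℕ := brandtXi (N / q) q (fun n => (freyCurve a b).LFunction n) with hξ
  set c : ℕ := ((freyCurve a b).minimalDiscriminantNorm ℤ).factorization q with hc
  -- (1) in `ℕ`, cast to `ℝ`
  have hnat : ξ * c ≤ 163 * D.deg * c ^ 2 :=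
    brandtXi_mul_factorization_le hT h68 hab h0 hN hq hq2 hqN D
  have hreal : (ξ : ℝ) * (c : ℝ) ≤ 163 * (D.deg : ℝ) * (c : ℝ) ^ 2 := by exact_mod_cast hnat
  -- the two inputs, constants clamped
  have hD' : (D.deg : ℝ) ≤ max C₁ 0 * (N : ℝ) ^ (2 + ε / 2) :=
    hD.trans (mul_le_mul_of_nonneg_right (le_max_left _ _) (Real.rpow_nonneg hN0 _))
  have hc' : (c : ℝ) ≤ max C₂ 0 * (N : ℝ) ^ (ε / 4) := by
    have h := hC₂ a b hab h0 N hN q (hq.odd_of_ne_two hq2)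
    rw [hq.primeFactors, Finset.prod_singleton] at h
    exact h.trans (mul_le_mul_of_nonneg_right (le_max_left _ _) (Real.rpow_nonneg hN0 _))
  have hc0 : (0 : ℝ) ≤ (c : ℝ) := Nat.cast_nonneg c
  -- exponents: `(N^{ε/4})² = N^{ε/2}` and `N^{2+ε/2} · N^{ε/2} = N^{2+ε}`
  have hsq : ((N : ℝ) ^ (ε / 4)) ^ 2 = (N : ℝ) ^ (ε / 2) := by
    rw [← Real.rpow_natCast ((N : ℝ) ^ (ε / 4)) 2, ← Real.rpow_mul hN0]
    congr 1
    push_cast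
    ring
  have hsplit : (N : ℝ) ^ (2 + ε / 2) * (N : ℝ) ^ (ε / 2) = (N : ℝ) ^ (2 + ε) := by
    rw [← Real.rpow_add hNpos]
    congr 1
    ring
  calc (ξ : ℝ) * (c : ℝ) ≤ 163 * (D.deg : ℝ) * (c : ℝ) ^ 2 := hreal
    _ ≤ 163 * (max C₁ 0 * (N : ℝ) ^ (2 + ε / 2)) * (max C₂ 0 * (N : ℝ) ^ (ε / 4)) ^ 2 := by
        gcongr
    _ = 163 * max C₁ 0 * (max C₂ 0) ^ 2 * ((N : ℝ) ^ (2 + ε / 2) * ((N : ℝ) ^ (ε / 4)) ^ 2) := by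
        ring
    _ = 163 * max C₁ 0 * (max C₂ 0) ^ 2 * (N : ℝ) ^ (2 + ε) := by rw [hsq, hsplit]

/-! ## (3) The prime rung `⟹ FreyDegreeBound`, and the calibration -/

/-- **The prime rung `⟹ FreyDegreeBound`** given the route items `DefiniteRTControlPrime`
(stmt-ABC-11338) and `FreyModularity` (stmt-ABC-11340): (E₁)
`DefiniteXiXiBoundUpgrade.minimalDegreeBound_of_primeXiStrongBound` gives the degree bound for
minimal data, and the proved glue `minimalBoundGivesTarget_proof` turns it into the thesis. [folklore] -/
theorem freyDegreeBound_of_primeXiStrongBound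
    (hXSq : ∀ ε : ℝ, 0 < ε → ∃ C : ℝ, ∀ a b : ℤ, IsCoprime a b → a * b * (a + b) ≠ 0 →
      ∀ (N : ℕ) [NeZero N], (freyCurve a b).conductorNorm ℤ = N → ∀ q : ℕ, q.Prime → q ≠ 2 → q ∣ N →
        (brandtXi (N / q) q (fun n => (freyCurve a b).LFunction n) : ℝ) *
          ((((freyCurve a b).minimalDiscriminantNorm ℤ).factorization q : ℕ) : ℝ) ≤
            C * (N : ℝ) ^ (2 + ε))
    (hRT : DefiniteRTControlPrime) (hMod : FreyModularity) : FreyDegreeBound :=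
  minimalBoundGivesTarget_proof hMod
    (DefiniteXiXiBoundUpgrade.minimalDegreeBound_of_primeXiStrongBound hXSq hRT)

/-- **THE CALIBRATION.**  Modulo Takahashi 2001 Thm. 2.3 at `q ∥ N`, Pasten 2024 Lemma 6.8 and the
route items `DefiniteRTControlPrime` (itself a consequence of those facts plus the Mazur–Kenku
degree transport, `definiteRTControlPrime_of_facts`) and `FreyModularity`, **the prime rung of the
crux `XiStrongBound` is EQUIVALENT to the thesis `FreyDegreeBound`**.  Hence no statement strictly
weaker than `X` closes stmt-ABC-11337 through its load-bearing rung: a line on this crux is a proof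
of Frey's degree conjecture on Frey curves (abc-equivalent given `PeterssonLowerBound`;
exponent `2` sharp, Masser 1990).
[cite: Takahashi2001, Thm. 2.3 (p. 79)] [cite: PastenShimura2024, Lemma 6.8 (p. 22)] -/
theorem primeXiStrongBound_iff_freyDegreeBound (hT : takahashi2001_thm_2_3_of_coprime)
    (h68 : PastenShimura2024_lemma_6_8) (hRT : DefiniteRTControlPrime) (hMod : FreyModularity) :
    (∀ ε : ℝ, 0 < ε → ∃ C : ℝ, ∀ a b : ℤ, IsCoprime a b → a * b * (a + b) ≠ 0 →
      ∀ (N : ℕ) [NeZero N], (freyCurve a b).conductorNorm ℤ = N → ∀ q : ℕ, q.Prime → q ≠ 2 → q ∣ N →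
        (brandtXi (N / q) q (fun n => (freyCurve a b).LFunction n) : ℝ) *
          ((((freyCurve a b).minimalDiscriminantNorm ℤ).factorization q : ℕ) : ℝ) ≤
            C * (N : ℝ) ^ (2 + ε)) ↔ FreyDegreeBound :=
  ⟨fun h => freyDegreeBound_of_primeXiStrongBound h hRT hMod,
    primeXiStrongBound_of_freyDegreeBound hT h68⟩

/-- **The calibration from the named facts alone** (plus `FreyModularity`): `DefiniteRTControlPrime` is
discharged by `DefiniteRTControlPrime.definiteRTControlPrime_of_facts` from Takahashi 2001 Thm. 2.3,
the Mazur–Kenku degree transport `PastenShimura2024_minimalDegree_le_163_mul` (= route crux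
`MazurKenkuBound`, stmt-ABC-15125) and Pasten 2024 Lemma 6.8 (= route crux
`IsogenyValuationTransport`, stmt-ABC-18928).  Registered on stmt-ABC-11337 as the calibration sub-goal of
line `SplitProof` (header fully qualified, verbatim the registered signature).
[cite: Takahashi2001, Thm. 2.3 (p. 79)] [cite: PastenShimura2024, §3 p. 13 and Lemma 6.8 (p. 22)] -/
theorem primeXiStrongBound_iff_freyDegreeBound_of_facts : Literature.NumberTheory.EllipticCurves.takahashi2001_thm_2_3_of_coprime → Literature.NumberTheory.EllipticCurves.ModularForms.PastenShimura2024_minimalDegree_le_163_mul → Literature.NumberTheory.EllipticCurves.ModularForms.PastenShimura2024_lemma_6_8 → Summit.ABC.ABC.Theses.DefiniteXi.FreyModularity → ((∀ ε : ℝ, 0 < ε → ∃ C : ℝ, ∀ a b : ℤ, IsCoprime a b → a * b * (a + b) ≠ 0 → ∀ (N : ℕ) [NeZero N], (Literature.NumberTheory.EllipticCurves.freyCurve a b).conductorNorm ℤ = N → ∀ q : ℕ, q.Prime → q ≠ 2 → q ∣ N → (Literature.NumberTheory.Automorphic.brandtXi (N / q) q (fun n => (Literature.NumberTheory.EllipticCurves.freyCurve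 a b).LFunction n) : ℝ) * ((((Literature.NumberTheory.EllipticCurves.freyCurve a b).minimalDiscriminantNorm ℤ).factorization q : ℕ) : ℝ) ≤ C * (N : ℝ) ^ (2 + ε)) ↔ Summit.ABC.ABC.Theses.DefiniteXi.FreyDegreeBound) :=
  fun hT h163 h68 hMod =>
    primeXiStrongBound_iff_freyDegreeBound hT h68 (definiteRTControlPrime_of_facts hT h163 h68) hMod

/-- **The full crux sits above the thesis, and only through its prime rung**: given
`DefiniteRTControlPrime` and `FreyModularity`, `XiStrongBound → FreyDegreeBound`, the implication
factoring through (E₃) `primeXiStrongBound_of_xiStrongBound` (the composite-`N⁻` instances are idle;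
cf. `WeightedSzpiroBound.freyDegreeBound_of_definiteXi`, the same implication via `DefiniteGlue`).
Conversely `FreyDegreeBound` returns the prime rung (`primeXiStrongBound_of_freyDegreeBound`); the
composite-`N⁻` instances of the crux would need the Ribet–Takahashi comparison for Shimura curves,
absent from the tree, and are not consumed by `closes`. [folklore] -/
theorem freyDegreeBound_of_xiStrongBound (hXS : XiStrongBound) (hRT : DefiniteRTControlPrime)
    (hMod : FreyModularity) : FreyDegreeBound :=
  freyDegreeBound_of_primeXiStrongBound
    (DefiniteXiXiBoundUpgrade.primeXiStrongBound_of_xiStrongBound hXS) hRT hMod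

end Summit.ABC.ABC.Theorems.DefiniteXiXiStrongBoundPrimeCalibration

end
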